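import Summits.CriticalPhenomena.PercolationContinuityZ3.Theorems.PercNearOneGluingNoHeavyQuantDepthTwoRelayCap
import Summits.CriticalPhenomena.PercolationContinuityZ3.Theorems.PercNearOneGluingNoHeavyQuantDepthTwoRows
import Summits.CriticalPhenomena.PercolationContinuityZ3.Theorems.PercNearOneGluingNoHeavyQuantPhantomRelay
import Summits.CriticalPhenomena.PercolationContinuityZ3.Theorems.PercNearOneGluingNoHeavyQuantSliceTwoRowRates
import HarnessLib

/-!
# QUANT lane R8, depth-2 closure (D2) in the RELAY case: THE ONE-ROW LEMMA, part 1 — the POINTWISE domination of the relay pull-back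
# of a single-threshold product row by ONE two-threshold factor row (lows, interior mids, layer endpoint)

builds on p205010 (kernel theorem, internal audit signed; external expert review pending)

Support file (`--supports stmt-CriticalPhenomena-4575`), QUANT lane seat prim-quant-census-2 (gen 67); census memo
`run/shared/lean/prim/quant/prim-quant-census-2-g67/DEPTH2-CLOSURE-G67.md` §4b.  Theorems only, standard axioms, no sorries.

THE LEMMA (relay case of the G₁-third of D2, one depth above G₀'s relay lemma `…QuantDepthOneRelayRow` ✓ p377094).  Floor `0 < y < 1`
(`u = y/(1−y)`), a nonnegative `μ` on `{0..M}`, a relay `ρ = {0: 1−g, 1: g}` with `y ≤ g ≤ 1` (its own top-affordability), a target `T`, a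
threshold `1 ≤ i` with `2i < T` (a factor low) and a product layer `i ≤ j`.  Put `s = T − 2i`, `θ₀ = min(1−g, s/(s+g))` and the layer `j*`:
`j* = j` if `j < M` and the pair `(i, j)` is NOT cheap at `T+g` (`T+g < i+j → u ≤ usage`), `j* = j−1` if `(i, j)` is a compatible cheap mid at
`T+g` (`usage ≤ u`).  IF `μ` satisfies the two-threshold row `TLC2_T(j*, i−1, i, θ₀)` in functional form
`Σ_a μ(a)·C(a) ≤ 0`, `C(a) = u[a ≤ i−1] + uθ₀[a = i] − [j*+1 ≤ a] − u[a ≤ j*]·cap2 y T j* (i−1) i a θ₀`,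
THEN `ν = lconv M 1 μ ρ` satisfies the single-threshold row `(j, i)` at `T + g` in functional form
`Σ_h ν(h)·C′(h) ≤ 0`, `C′(h) = u[h ≤ i] − [j+1 ≤ h] − u[h ≤ j ∧ T+g < i+h]/usage y (T+g) j i h`
(part 2, `…QuantDepthTwoRelayRow`: `relayConv_tlcRow_same_layer`, `relayConv_tlcRow_lower_layer`).  PROOF: `Σ_h ν(h)C′(h) = Σ_a μ(a)·((1−g)C′(a) + gC′(a+1))`
(`sum_fun_mul_lconv_one`, lead g38) and the POINTWISE domination `(1−g)C′(a) + gC′(a+1) ≤ C(a)` (`relay_pointwise_*`): equality on the lows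
`a ≤ i−1`; at `a = i` the three cases of `C′(i+1)` give exactly `θ₀`; on a mid of the factor row the `θ₀`-branch of `cap2` is the relay
capacity inequality `relay_cap_pairGate` / `relay_cap_pairGate_top` (`…QuantDepthTwoRelayCap`, this seat) and the `(i−1)`-branch is
monotonicity of the minimal gate in `ρ` (`pairGate_mono_rho`, lead g22 `…QuantSliceTwoRowRates`); the layer rule makes the top atom `a = j` a giant exactly when it must be.
EXACT CENSUS behind the statement (memo §4b, `code/local/local_onerow7.py`): 495 695 instances (floors .2–.9, M ≤ 26, any target, g ∈ [y,1])
/ 0 exceptions.  HONEST STATUS: D2, G₁ and `Quant.FarTreeRow` (light) remain OPEN; nothing here is cited as a published result; the lane's RATE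
class log\* and honest sentence (`run/shared/lean/prim/quant/README.md`) are unchanged.

[this work]; bookkeeping `sum_fun_mul_lconv_one`: prim-quant-lead g38 (`…QuantPhantomRelay`); `cap2`/`TLC2`: prim-quant-census-2 g64
(`…QuantDepthTwoRows`); minimal gates: prim-quant-stmt g22.  The gluing rows served [cite: KozmaNitzan2024, Conjecture 3 (p. 15)]; product measure
[cite: Grimmett1999, §1.3 p. 10].
-/

noncomputable section

namespace Summit.CriticalPhenomena.PercolationContinuityZ3.Theorems

namespace Quant

open Finset

namespace LawDec

/-! ### Small facts about the minimal gate and the usage of a pair below the layer -/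

/-- for a pair below the layer, `usage` is the mid form `pairGate/(1 − pairGate)`. [this work] -/
theorem usage_of_le_layer (x T : ℝ) (j l h : ℕ) (hh : h ≤ j) :
    usage x T j l h = pairGate x T l h / (1 - pairGate x T l h) := by
  have hnj : ¬ (j + 1 ≤ h) := by omega
  simp only [usage, gateOf, if_neg hnj]

/-- a compatible pair below the layer has positive usage and `1/usage = 1/pairGate − 1 > 0`‐type capacity:
`0 < y < 1`, `2l < T < l + h`, `h ≤ j`. [this work] -/
theorem one_div_usage_eq_cap (y T : ℝ) (j l h : ℕ) (hy0 : 0 < y) (hy1 : y < 1) (hh : h ≤ j)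
    (hlow : 2 * (l : ℝ) < T) (hcomp : T < (l : ℝ) + h) :
    1 / usage y T j l h = max 0 (1 / pairGate y T l h - 1) := by
  have hlh : l < h := by
    have : (l : ℝ) < h := by linarith
    exact_mod_cast this
  have hG0 : 0 < pairGate y T l h := pairGate_pos y T l h hlow hlh
  have hG1 : pairGate y T l h < 1 := pairGate_lt_one y T l h hy0 hy1 hlow hcomp
  rw [one_div_usage_of_le_layer y T j l h hh hG0.ne']
  symm
  refine max_eq_right ?_
  rw [sub_nonneg, le_div_iff₀ hG0]
  linarith

/-- an incompatible pair (`l + h ≤ T`, `l < h`) has clipped capacity `0`: `max 0 (1/pairGate − 1) = 0` (any floor). [this work] -/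
theorem cap_clip_eq_zero (y T : ℝ) (l h : ℕ) (hlh : l < h) (hnc : ¬ T < (l : ℝ) + h) :
    max 0 (1 / pairGate y T l h - 1) = 0 := by
  refine max_eq_left ?_
  have hd : (0 : ℝ) < (h : ℝ) - l := by
    have : (l : ℝ) < h := by exact_mod_cast hlh
    linarith
  have hρ1 : 1 ≤ (T - 2 * (l : ℝ)) / ((h : ℝ) - l) := by
    rw [le_div_iff₀ hd]; linarith
  have hG1 : 1 ≤ pairGate y T l h := le_trans hρ1 (le_max_left _ _)
  have : 1 / pairGate y T l h ≤ 1 := by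
    rw [div_le_one (by linarith)]; exact hG1
  linarith

/-- the minimal gate is at least the floor iff `ρ ≥ y`: `y ≤ pairGate y T l h ↔ y ≤ ρ` direction used: `y ≤ pairGate → y ≤ ρ`
(`0 < y < 1`). [this work] -/
theorem rho_ge_of_pairGate_ge (y T : ℝ) (l h : ℕ) (hy1 : y < 1)
    (hG : y ≤ pairGate y T l h) : y ≤ (T - 2 * (l : ℝ)) / ((h : ℝ) - l) := by
  by_contra hlt
  rw [not_le] at hlt
  have : pairGate y T l h < y := by
    refine max_lt hlt ?_
    nlinarith
  linarith

/-- `usage ≥ u` below the layer forces `pairGate ≥ y` (`0 < y < 1`). [this work] -/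
theorem pairGate_ge_of_usage_ge (y T : ℝ) (j l h : ℕ) (hy1 : y < 1) (hh : h ≤ j)
    (hG1 : pairGate y T l h < 1) (hu : y / (1 - y) ≤ usage y T j l h) : y ≤ pairGate y T l h := by
  rw [usage_of_le_layer y T j l h hh] at hu
  have h1 : 0 < 1 - pairGate y T l h := by linarith
  have h2 : 0 < 1 - y := by linarith
  rw [div_le_div_iff₀ h2 h1] at hu
  nlinarith

/-- `usage ≤ u` below the layer forces `1/usage ≥ (1−y)/y` for a compatible pair (`0 < y < 1`). [this work] -/
theorem one_div_usage_ge_of_usage_le (y T : ℝ) (j l h : ℕ) (hy0 : 0 < y) (hy1 : y < 1)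
    (hlow : 2 * (l : ℝ) < T) (hcomp : T < (l : ℝ) + h) (hu : usage y T j l h ≤ y / (1 - y)) :
    (1 - y) / y ≤ 1 / usage y T j l h := by
  have hlh : l < h := by
    have : (l : ℝ) < h := by linarith
    exact_mod_cast this
  have hpos : 0 < usage y T j l h := usage_pos_of_compat y T j l h hy0 hy1 hlow hlh (Or.inr hcomp)
  rw [div_le_div_iff₀ hy0 hpos]
  have h2 : 0 < 1 - y := by linarith
  rw [le_div_iff₀ h2] at hu
  nlinarith

/-! ### The pointwise domination of the pull-back by one two-threshold row (same-layer case `j* = j`) -/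

/-- **POINTWISE, LOWS** (`a ≤ i`): on the lows `a ≤ i−1` the pull-back price is `u` = the factor row's price; at the top low `a = i` the
pull-back price `(1−g)u + g·C′(i+1)` is at most `u·θ₀`, `θ₀ = min(1−g, s/(s+g))` (three cases of `C′(i+1)`: compatible mid `i+1`, incompatible
mid, giant `j = i`).  `0 < y < 1`, `y ≤ g ≤ 1`, `1 ≤ i ≤ j`, `2i < T`. [this work] -/
theorem relay_pointwise_lows (y T g : ℝ) (i j js : ℕ) (Cp Cf : ℕ → ℝ)
    (hy0 : 0 < y) (hy1 : y < 1) (hyg : y ≤ g) (hi : 1 ≤ i) (hij : i ≤ j) (hijs : i ≤ js) (hlow : 2 * (i : ℝ) < T)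
    (hCp : ∀ h : ℕ, Cp h = y / (1 - y) * (if h ≤ i then (1 : ℝ) else 0) - (if j + 1 ≤ h then (1 : ℝ) else 0)
      - y / (1 - y) * (if h ≤ j ∧ T + g < (i : ℝ) + h then 1 / usage y (T + g) j i h else 0))
    (hCf : ∀ a : ℕ, Cf a = y / (1 - y) * (if a ≤ i - 1 then (1 : ℝ) else 0)
      + y / (1 - y) * min (1 - g) ((T - 2 * (i : ℝ)) / (T - 2 * (i : ℝ) + g)) * (if a = i then (1 : ℝ) else 0)
      - (if js + 1 ≤ a then (1 : ℝ) else 0) - y / (1 - y) * (if a ≤ js then cap2 y T js (i - 1) i a (min (1 - g) ((T - 2 * (i : ℝ)) / (T - 2 * (i : ℝ) + g))) else 0))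
    (a : ℕ) (ha : a ≤ i) : (1 - g) * Cp a + g * Cp (a + 1) ≤ Cf a := by
  have h1y : 0 < 1 - y := by linarith
  have hu0 : 0 < y / (1 - y) := div_pos hy0 h1y
  set u : ℝ := y / (1 - y) with hu
  set s : ℝ := T - 2 * (i : ℝ) with hs
  have hs0 : 0 < s := by rw [hs]; linarith
  have hg0 : 0 < g := lt_of_lt_of_le hy0 hyg
  have hA : 0 < s + g := by linarith
  have hi1 : ((i - 1 : ℕ) : ℝ) = (i : ℝ) - 1 := by rw [Nat.cast_sub hi, Nat.cast_one]
  -- the factor row's `cap2` vanishes at every `a ≤ i` (neither `i−1` nor `i` is compatible with `a ≤ i`)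
  have hcap0 : cap2 y T js (i - 1) i a (min (1 - g) (s / (s + g))) = 0 := by
    have ha' : (a : ℝ) ≤ i := by exact_mod_cast ha
    unfold cap2
    rw [if_neg (by rw [hi1]; linarith), if_neg (by linarith), max_self]
  -- the value `Cp a = u`
  have hCpa : Cp a = u := by
    rw [hCp a, if_pos ha, if_neg (by omega)]
    have : ¬ (a ≤ j ∧ T + g < (i : ℝ) + a) := by
      rintro ⟨_, h2⟩
      have ha' : (a : ℝ) ≤ i := by exact_mod_cast ha
      linarith
    rw [if_neg this]; ring
  rcases Nat.lt_or_ge a i with hlt | hge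
  · -- a ≤ i − 1: everything is `u`
    have hCpa1 : Cp (a + 1) = u := by
      rw [hCp (a + 1), if_pos (by omega), if_neg (by omega)]
      have : ¬ (a + 1 ≤ j ∧ T + g < (i : ℝ) + ((a + 1 : ℕ) : ℝ)) := by
        rintro ⟨_, h2⟩
        have ha' : ((a + 1 : ℕ) : ℝ) ≤ i := by exact_mod_cast hlt
        linarith
      rw [if_neg this]; ring
    have hCfa : Cf a = u := by
      rw [hCf a, if_pos (by omega), if_neg (by omega), if_neg (by omega), if_pos (le_trans ha hijs), hcap0]
      ring
    rw [hCpa, hCpa1, hCfa]; linarith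
  · -- a = i
    have hai : a = i := le_antisymm ha hge
    subst hai
    have hCfa : Cf a = u * min (1 - g) (s / (s + g)) := by
      rw [hCf a, if_neg (by omega), if_pos rfl, if_neg (by omega), if_pos hijs, hcap0]
      ring
    rw [hCpa, hCfa]
    -- the three cases of `Cp (i+1)`
    by_cases hji : j + 1 ≤ a + 1
    · -- j = i: atom i+1 is a giant of the product row
      have hCp1 : Cp (a + 1) = -1 := by
        rw [hCp (a + 1), if_neg (by omega), if_pos hji]
        have : ¬ (a + 1 ≤ j ∧ T + g < (a : ℝ) + ((a + 1 : ℕ) : ℝ)) := by rintro ⟨h1, _⟩; omega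
        rw [if_neg this]; ring
      rw [hCp1]
      have hmin1 : (1 - g) * u + g * (-1) ≤ u * (1 - g) := by nlinarith
      have hmin2 : (1 - g) * u + g * (-1) ≤ u * (s / (s + g)) := by
        -- u(1−g) − g ≤ u·s/(s+g)  ⟸  y ≤ s + g
        rw [show u * (s / (s + g)) = u - u * (g / (s + g)) by field_simp; ring]
        have hk : u * (g / (s + g)) ≤ g * u + g - g * u * 0 := by
          rw [show u * (g / (s + g)) = g * (u / (s + g)) by ring]
          have : u / (s + g) ≤ u + 1 := by
            rw [div_le_iff₀ hA]
            have hys : y ≤ s + g := by linarith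
            have : u = y / (1 - y) := hu
            have hu1 : u * (1 - y) = y := by rw [hu]; field_simp
            nlinarith [mul_nonneg hu0.le hA.le]
          nlinarith [mul_le_mul_of_nonneg_left this hg0.le]
        nlinarith
      rcases min_cases (1 - g) (s / (s + g)) with ⟨hm, _⟩ | ⟨hm, _⟩ <;> rw [hm] <;> assumption
    · -- i + 1 ≤ j
      have hij' : a + 1 ≤ j := by omega
      by_cases hc : T + g < (a : ℝ) + ((a + 1 : ℕ) : ℝ)
      · -- compatible mid i+1 at the raised target: 1/usage = 1/(s+g) − 1
        have hCp1 : Cp (a + 1) = -(u * (1 / (s + g) - 1)) := by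
          rw [hCp (a + 1), if_neg (by omega), if_neg hji, if_pos ⟨hij', hc⟩]
          have hG : pairGate y (T + g) a (a + 1) = s + g := by
            unfold pairGate
            push_cast
            rw [show (a : ℝ) + 1 - a = 1 by ring, div_one, show T + g - 2 * (a : ℝ) = s + g by rw [hs]; ring]
            exact BlobDec2.gate_eq_heavy y (s + g) hy0.le (by linarith)
          rw [one_div_usage_of_le_layer y (T + g) j a (a + 1) hij' (by rw [hG]; exact hA.ne'), hG]
          ring
        rw [hCp1]
        have hsg1 : s + g < 1 := by
          have : T + g < (a : ℝ) + ((a : ℝ) + 1) := by push_cast at hc; linarith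
          rw [hs]; linarith
        have hval : (1 - g) * u + g * -(u * (1 / (s + g) - 1)) = u * (s / (s + g)) := by
          field_simp
          ring
        rw [hval]
        have hle : s / (s + g) ≤ 1 - g := by
          rw [div_le_iff₀ hA]; nlinarith
        rw [min_eq_right hle]
      · -- incompatible mid i+1: Cp (i+1) = 0 and θ₀ = 1 − g
        have hCp1 : Cp (a + 1) = 0 := by
          rw [hCp (a + 1), if_neg (by omega), if_neg hji]
          have : ¬ (a + 1 ≤ j ∧ T + g < (a : ℝ) + ((a + 1 : ℕ) : ℝ)) := fun h => hc h.2
          rw [if_neg this]; ring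
        rw [hCp1]
        have hsg1 : 1 ≤ s + g := by
          have : ¬ T + g < (a : ℝ) + ((a : ℝ) + 1) := by push_cast at hc; exact hc
          rw [hs]; linarith
        have hle : 1 - g ≤ s / (s + g) := by
          rw [le_div_iff₀ hA]; nlinarith
        rw [min_eq_left hle]
        linarith

/-- **POINTWISE, INTERIOR MIDS** (`i < a`, `a + 1 ≤ j`): the factor row's two-branch capacity `cap2` at `a` is covered by the pull-back's
capacities — the `θ₀`-branch by the relay capacity inequality `relay_cap_pairGate`, the `(i−1)`-branch by monotonicity of the minimal gate. [this work] -/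
theorem relay_pointwise_mids (y T g : ℝ) (i j js : ℕ) (Cp Cf : ℕ → ℝ)
    (hy0 : 0 < y) (hy1 : y < 1) (hyg : y ≤ g) (hg1 : g ≤ 1) (hi : 1 ≤ i) (hlow : 2 * (i : ℝ) < T)
    (hCp : ∀ h : ℕ, Cp h = y / (1 - y) * (if h ≤ i then (1 : ℝ) else 0) - (if j + 1 ≤ h then (1 : ℝ) else 0)
      - y / (1 - y) * (if h ≤ j ∧ T + g < (i : ℝ) + h then 1 / usage y (T + g) j i h else 0))
    (hCf : ∀ a : ℕ, Cf a = y / (1 - y) * (if a ≤ i - 1 then (1 : ℝ) else 0)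
      + y / (1 - y) * min (1 - g) ((T - 2 * (i : ℝ)) / (T - 2 * (i : ℝ) + g)) * (if a = i then (1 : ℝ) else 0)
      - (if js + 1 ≤ a then (1 : ℝ) else 0) - y / (1 - y) * (if a ≤ js then cap2 y T js (i - 1) i a (min (1 - g) ((T - 2 * (i : ℝ)) / (T - 2 * (i : ℝ) + g))) else 0))
    (a : ℕ) (hia : i < a) (haj : a + 1 ≤ j) (hajs : a ≤ js) : (1 - g) * Cp a + g * Cp (a + 1) ≤ Cf a := by
  have h1y : 0 < 1 - y := by linarith
  have hu0 : 0 < y / (1 - y) := div_pos hy0 h1y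
  set u : ℝ := y / (1 - y) with hu
  set θ₀ : ℝ := min (1 - g) ((T - 2 * (i : ℝ)) / (T - 2 * (i : ℝ) + g)) with hθ
  have hg0 : 0 < g := lt_of_lt_of_le hy0 hyg
  have h1g : 0 ≤ 1 - g := by linarith
  have hi1 : ((i - 1 : ℕ) : ℝ) = (i : ℝ) - 1 := by rw [Nat.cast_sub hi, Nat.cast_one]
  have hia' : (i : ℝ) < a := by exact_mod_cast hia
  -- the clipped capacities of the pull-back at `a` and `a+1`
  set X0 : ℝ := max 0 (1 / pairGate y (T + g) i a - 1) with hX0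
  set X1 : ℝ := max 0 (1 / pairGate y (T + g) i (a + 1) - 1) with hX1
  have hX0n : 0 ≤ X0 := le_max_left _ _
  have hX1n : 0 ≤ X1 := le_max_left _ _
  have hCpa : Cp a = -(u * X0) := by
    rw [hCp a, if_neg (by omega), if_neg (by omega)]
    by_cases hc : T + g < (i : ℝ) + a
    · rw [if_pos ⟨by omega, hc⟩, one_div_usage_eq_cap y (T + g) j i a hy0 hy1 (by omega) (by linarith) hc]; ring
    · rw [if_neg (fun h => hc h.2), hX0, cap_clip_eq_zero y (T + g) i a hia hc]; ring
  have hCpa1 : Cp (a + 1) = -(u * X1) := by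
    rw [hCp (a + 1), if_neg (by omega), if_neg (by omega)]
    by_cases hc : T + g < (i : ℝ) + ((a + 1 : ℕ) : ℝ)
    · rw [if_pos ⟨haj, hc⟩, one_div_usage_eq_cap y (T + g) j i (a + 1) hy0 hy1 haj (by linarith) hc]; ring
    · rw [if_neg (fun h => hc h.2), hX1, cap_clip_eq_zero y (T + g) i (a + 1) (by omega) hc]; ring
  have hCfa : Cf a = -(u * cap2 y T js (i - 1) i a θ₀) := by
    rw [hCf a, if_neg (by omega), if_neg (by omega), if_neg (by omega), if_pos hajs]; ring
  rw [hCpa, hCpa1, hCfa]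
  -- it suffices: cap2 ≤ (1−g) X0 + g X1
  suffices hkey : cap2 y T js (i - 1) i a θ₀ ≤ (1 - g) * X0 + g * X1 by nlinarith [mul_le_mul_of_nonneg_left hkey hu0.le]
  -- monotonicity facts: X0 ≤ X1, and the (i−1)-branch capacity ≤ X0
  have hρa : (T + g - 2 * (i : ℝ)) / (((a + 1 : ℕ) : ℝ) - i) ≤ (T + g - 2 * (i : ℝ)) / ((a : ℝ) - i) := by
    push_cast
    exact div_le_div_of_nonneg_left (by linarith) (by linarith) (by linarith)
  have hG01 : pairGate y (T + g) i (a + 1) ≤ pairGate y (T + g) i a := pairGate_mono_rho y _ _ i (a + 1) i a hy1.le hρa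
  have hGa0 : 0 < pairGate y (T + g) i a := pairGate_pos y (T + g) i a (by linarith) hia
  have hGa1 : 0 < pairGate y (T + g) i (a + 1) := pairGate_pos y (T + g) i (a + 1) (by linarith) (by omega)
  have hX01 : X0 ≤ X1 := by
    rw [hX0, hX1]
    exact max_le_max le_rfl (by linarith [one_div_le_one_div_of_le hGa1 hG01])
  unfold cap2
  refine max_le ?_ ?_
  · -- the (i−1)-branch
    split_ifs with hc1
    · have hc1' : T < (i : ℝ) - 1 + a := by rwa [hi1] at hc1
      have hcomp : T + g < (i : ℝ) + a := by linarith
      -- ρ_{T+g}(i, a) ≤ ρ_T(i−1, a)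
      have hρ : (T + g - 2 * (i : ℝ)) / ((a : ℝ) - i) ≤ (T - 2 * ((i - 1 : ℕ) : ℝ)) / ((a : ℝ) - ((i - 1 : ℕ) : ℝ)) := by
        rw [hi1, div_le_div_iff₀ (by linarith) (by linarith)]
        nlinarith [mul_nonneg h1g (show (0:ℝ) ≤ (a:ℝ) - i - 1 by linarith)]
      have hGle : pairGate y (T + g) i a ≤ pairGate y T (i - 1) a := pairGate_mono_rho y _ _ i a (i - 1) a hy1.le hρ
      have hb1 : 1 / usage y T js (i - 1) a ≤ X0 := by
        rw [one_div_usage_eq_cap y T js (i - 1) a hy0 hy1 hajs (by rw [hi1]; linarith) hc1, hX0]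
        exact max_le_max le_rfl (by linarith [one_div_le_one_div_of_le hGa0 hGle])
      nlinarith
    · nlinarith
  · -- the θ₀-branch: the relay capacity inequality
    split_ifs with hc2
    · rw [div_eq_mul_one_div θ₀, one_div_usage_eq_cap y T js i a hy0 hy1 hajs hlow hc2]
      have := relay_cap_pairGate y T g i a hy0 hy1 hyg hg1 hlow hc2
      rw [← hθ] at this
      exact this
    · nlinarith

/-- **POINTWISE, THE LAYER ENDPOINT** (`i < j = a`, same-layer case: the pair `(i, j)` is not cheap at `T+g`): the shifted copy sees the giant
`j+1` (rate `(1−y)/y` per unit of price), `relay_cap_pairGate_top`. [this work] -/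
theorem relay_pointwise_top (y T g : ℝ) (i j : ℕ) (Cp Cf : ℕ → ℝ)
    (hy0 : 0 < y) (hy1 : y < 1) (hyg : y ≤ g) (hg1 : g ≤ 1) (hi : 1 ≤ i) (hlow : 2 * (i : ℝ) < T) (hij : i < j)
    (hexp : T + g < (i : ℝ) + j → y / (1 - y) ≤ usage y (T + g) j i j)
    (hCp : ∀ h : ℕ, Cp h = y / (1 - y) * (if h ≤ i then (1 : ℝ) else 0) - (if j + 1 ≤ h then (1 : ℝ) else 0)
      - y / (1 - y) * (if h ≤ j ∧ T + g < (i : ℝ) + h then 1 / usage y (T + g) j i h else 0))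
    (hCf : ∀ a : ℕ, Cf a = y / (1 - y) * (if a ≤ i - 1 then (1 : ℝ) else 0)
      + y / (1 - y) * min (1 - g) ((T - 2 * (i : ℝ)) / (T - 2 * (i : ℝ) + g)) * (if a = i then (1 : ℝ) else 0)
      - (if j + 1 ≤ a then (1 : ℝ) else 0) - y / (1 - y) * (if a ≤ j then cap2 y T j (i - 1) i a (min (1 - g) ((T - 2 * (i : ℝ)) / (T - 2 * (i : ℝ) + g))) else 0)) :
    (1 - g) * Cp j + g * Cp (j + 1) ≤ Cf j := by
  have h1y : 0 < 1 - y := by linarith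
  have hu0 : 0 < y / (1 - y) := div_pos hy0 h1y
  set u : ℝ := y / (1 - y) with hu
  set θ₀ : ℝ := min (1 - g) ((T - 2 * (i : ℝ)) / (T - 2 * (i : ℝ) + g)) with hθ
  have hg0 : 0 < g := lt_of_lt_of_le hy0 hyg
  have h1g : 0 ≤ 1 - g := by linarith
  have hi1 : ((i - 1 : ℕ) : ℝ) = (i : ℝ) - 1 := by rw [Nat.cast_sub hi, Nat.cast_one]
  have hij' : (i : ℝ) < j := by exact_mod_cast hij
  set X0 : ℝ := max 0 (1 / pairGate y (T + g) i j - 1) with hX0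
  have hX0n : 0 ≤ X0 := le_max_left _ _
  have hGj0 : 0 < pairGate y (T + g) i j := pairGate_pos y (T + g) i j (by linarith) hij
  have hCpj : Cp j = -(u * X0) := by
    rw [hCp j, if_neg (by omega), if_neg (by omega)]
    by_cases hc : T + g < (i : ℝ) + j
    · rw [if_pos ⟨le_rfl, hc⟩, one_div_usage_eq_cap y (T + g) j i j hy0 hy1 le_rfl (by linarith) hc]; ring
    · rw [if_neg (fun h => hc h.2), hX0, cap_clip_eq_zero y (T + g) i j hij hc]; ring
  have hCpj1 : Cp (j + 1) = -1 := by
    rw [hCp (j + 1), if_neg (by omega), if_pos le_rfl]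
    have : ¬ (j + 1 ≤ j ∧ T + g < (i : ℝ) + ((j + 1 : ℕ) : ℝ)) := by rintro ⟨h, _⟩; omega
    rw [if_neg this]; ring
  have hCfj : Cf j = -(u * cap2 y T j (i - 1) i j θ₀) := by
    rw [hCf j, if_neg (by omega), if_neg (by omega), if_neg (by omega), if_pos le_rfl]; ring
  rw [hCpj, hCpj1, hCfj]
  -- the pair (i, j) is not cheap at T + g: ρ' ≥ y, hence X0 ≤ (1−y)/y = 1/u
  have hρtop : y ≤ (T + g - 2 * (i : ℝ)) / ((j : ℝ) - i) := by
    by_cases hc : T + g < (i : ℝ) + j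
    · have hG1 : pairGate y (T + g) i j < 1 := pairGate_lt_one y (T + g) i j hy0 hy1 (by linarith) hc
      exact rho_ge_of_pairGate_ge y (T + g) i j hy1 (pairGate_ge_of_usage_ge y (T + g) j i j hy1 le_rfl hG1 (hexp hc))
    · rw [le_div_iff₀ (by linarith)]; nlinarith
  have hX0le : X0 ≤ (1 - y) / y := by
    rw [hX0]
    refine max_le (div_nonneg h1y.le hy0.le) ?_
    have hGy : y ≤ pairGate y (T + g) i j := le_trans hρtop (le_max_left _ _)
    have := one_div_le_one_div_of_le hy0 hGy
    have e : (1 - y) / y = 1 / y - 1 := by field_simp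
    rw [e]; linarith
  have hug : g * (-1 : ℝ) = -(u * (g * ((1 - y) / y))) := by rw [hu]; field_simp
  suffices hkey : cap2 y T j (i - 1) i j θ₀ ≤ (1 - g) * X0 + g * ((1 - y) / y) by
    rw [hug]; nlinarith [mul_le_mul_of_nonneg_left hkey hu0.le]
  unfold cap2
  refine max_le ?_ ?_
  · split_ifs with hc1
    · have hc1' : T < (i : ℝ) - 1 + j := by rwa [hi1] at hc1
      have hρ : (T + g - 2 * (i : ℝ)) / ((j : ℝ) - i) ≤ (T - 2 * ((i - 1 : ℕ) : ℝ)) / ((j : ℝ) - ((i - 1 : ℕ) : ℝ)) := by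
        rw [hi1, div_le_div_iff₀ (by linarith) (by linarith)]
        nlinarith [mul_nonneg h1g (show (0:ℝ) ≤ (j:ℝ) - i - 1 by linarith)]
      have hGle : pairGate y (T + g) i j ≤ pairGate y T (i - 1) j := pairGate_mono_rho y _ _ i j (i - 1) j hy1.le hρ
      have hb1 : 1 / usage y T j (i - 1) j ≤ X0 := by
        rw [one_div_usage_eq_cap y T j (i - 1) j hy0 hy1 le_rfl (by rw [hi1]; linarith) hc1, hX0]
        exact max_le_max le_rfl (by linarith [one_div_le_one_div_of_le hGj0 hGle])
      nlinarith
    · nlinarith [div_nonneg h1y.le hy0.le]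
  · split_ifs with hc2
    · rw [div_eq_mul_one_div θ₀, one_div_usage_eq_cap y T j i j hy0 hy1 le_rfl hlow hc2]
      have := relay_cap_pairGate_top y T g i j hy0 hy1 hyg hg1 hlow hc2 hρtop
      rw [← hθ] at this
      exact this
    · nlinarith [div_nonneg h1y.le hy0.le]

end LawDec

end Quant

end Summit.CriticalPhenomena.PercolationContinuityZ3.Theorems
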